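import Literature.Analysis.DeBrangesSpaces.BurnolSonineStructureFunction
import Literature.NumberTheory.ConnesConsani2021.SoninSpaceInfiniteDimensional
import HarnessLib

/-!
# Burnol 2002 (CRAS 335), Théorème 4 and Corollaire 5: the orthogonal projection onto the Sonine
# space `K_λ` in closed form — proofs

LABEL (line 1): **RH-FREE** — operator algebra with the two cutoff projections `P_λ` and
`P̃_λ = 𝓕⁻¹P_λ𝓕` on `L²(ℝ)`, the compression `F_λ = P_λ𝓕₊P_λ` and `D_λ = F_λ²`; `ζ` does not occur.
bears_on: LADDER-RH COLUMN 6 (DBR), B-C, as corpus vocabulary only. WHAT THIS IS NOT: not a route,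
not a criterion; nothing here bears on the truth of RH.

PROOF-ONLY companion of `BurnolSonineStructureFunction.lean` (J.-F. Burnol, *Sur les « espaces de
Sonine » associés par de Branges à la transformation de Fourier*, C. R. Math. Acad. Sci. Paris **335**
(2002) 689–692 = arXiv:math/0208121 [Burnol2002CRAS]; TeX of record
`dbl/src/Burnol2002CRAS_arXivmath0208121.tex`). It DISCHARGES the named facts

* `Burnol2002CRAS_thm4` (Théorème 4, TeX l.310–319): `1 − D_λ` is invertible and, for every even
  square-integrable `f`,
  `π_λ(f) = f − (1 − D_λ)^{-1}(P_λ f − F_λ 𝓕₊ f) − 𝓕₊ (1 − D_λ)^{-1}(P_λ 𝓕₊ f − F_λ f)`;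
* `Burnol2002CRAS_cor5` (Corollaire 5, TeX l.321–333): the three specialisations
  `f|_{(−λ,λ)} = 0`, `𝓕₊ f = f`, `𝓕₊ f = −f`.

## The argument (printed: "Si l'on combine les formules précédentes on obtient", TeX l.308)

Burnol reads the formula off Lemme 2 (the orthogonal projection onto
`G_λ = P_λ(L²)^{pair} + P̃_λ(L²)^{pair}` is `(P_λ + P̃_λ)|_{G_λ}^{-1}(P_λ + P̃_λ)`, with the `2 × 2`
inverse `(u,v) ↦ ((1−D_λ)^{-1}(u − F_λ v), (1−D_λ)^{-1}(−F_λ u + v))`, TeX l.279–288). We verify the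
combined formula directly, which is the same computation run forward:

1. `‖F_λ‖ < 1`: on `L²(ℝ)` one has `F_λ = P_λ ∘ P̃_λ ∘ 𝓕` (`𝓕² =` reflection, which commutes with
   `P_λ` and fixes `𝓕⁻¹ ↦ 𝓕`), so `‖F_λ‖ ≤ ‖P_λ P̃_λ‖ < 1` by the Connes–Consani cell's
   `Literature.NumberTheory.ConnesConsani2021.norm_cutoffProj_comp_cutoffProjHat_lt_one` (Burnol:
   "`F_λ` compact auto-adjoint de norme strictement inférieure à `1`", TeX l.283–284); hence
   `‖D_λ‖ < 1` and `1 − D_λ`, `1 ± F_λ` are units (`isUnit_one_sub_slepianD`, …).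
2. With `A = (1 − D_λ)^{-1}`, `x₁ = P f − F 𝓕 f`, `x₂ = P 𝓕 f − F f` and the printed
   `k = A x₁ + 𝓕 (A x₂)`: `P k = A(x₁ + F x₂) = A(1 − D)P f = P f` and, for even `f`,
   `P̃ k = 𝓕 A(F x₁ + x₂) = 𝓕 A (1 − D) P 𝓕 f = 𝓕 P 𝓕 f = P̃ f` (`A` commutes with `F`; `FP = F = PF`;
   `𝓕⁻¹ = 𝓕` on even classes); and `k ∈ ran P_λ + ran P̃_λ`.
3. Hence `f − k` is even and killed by `P_λ` and `P̃_λ`, i.e. lies in Sonin's space `S(λ,λ)`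
   (`mem_soninSpace_iff_cutoffProj`), while `k ⊥ S(λ,λ)`; by uniqueness of the orthogonal
   decomposition `π_λ f = f − k` (`soninProjection = (soninSpace λ λ).starProjection`).
4. Corollaire 5: substitute `P f = 0` (so `F f = 0`), resp. `𝓕 f = ± f` (so `x₂ = ± x₁`,
   `x₁ = (1 ∓ F) P f` and `(1 − F²)^{-1}(1 ∓ F) = (1 ± F)^{-1}`).

No definitions, no new named facts (D-0026).

## References
* [Burnol2002CRAS] J.-F. Burnol, C. R. Math. Acad. Sci. Paris 335 (2002) 689–692 = arXiv:math/0208121,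
  Lemme 2 (proof, TeX l.279–288), Théorème 4 (TeX l.310–319), Corollaire 5 (TeX l.321–333).
* [Burnol2004] J.-F. Burnol, *On Fourier and Zeta(s)*, Forum Math. 16 (2004), §6 (`‖P_λ𝓕₊P_λ‖ < 1`;
  tree file `SoninSpaceInfiniteDimensional.lean`).
-/

noncomputable section

open _root_.MeasureTheory _root_.Complex _root_.Set _root_.Filter
open scoped Real Topology FourierTransform InnerProductSpace
open Literature.NumberTheory.LFunctions (evenL2)
open Literature.NumberTheory.ConnesConsani2021 (cutoffProj cutoffProjHat soninSpace soninProjection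
  evenPart mem_soninSpace_iff_cutoffProj isStarProjection_cutoffProj isStarProjection_cutoffProjHat
  compNeg_cutoffProj compNeg_cutoffProjHat norm_cutoffProj_comp_cutoffProjHat_lt_one
  fourier_cutoffProj_fourierInv cutoffProjHat_apply cutoffProj_idem)
open Literature.Analysis.Fourier (coeFn_compNeg compNeg_compNeg fourier_compNeg fourierInv_compNeg
  fourierInv_eq_compNeg_fourier fourier_fourier_eq_compNeg)

namespace Literature.Analysis.DeBrangesSpaces

namespace Burnol2002

/-! ## Abstract tools -/

section Abstract

variable {E : Type*} [NormedAddCommGroup E] [InnerProductSpace ℂ E] [CompleteSpace E]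

/-- For a star projection `Q`, `Re ⟪x, Q x⟫ = ‖Q x‖²`. [folklore] -/
private theorem re_inner_apply_of_isStarProjection {Q : E →L[ℂ] E} (hQ : IsStarProjection Q)
    (x : E) : RCLike.re ⟪x, Q x⟫_ℂ = ‖Q x‖ ^ 2 := by
  have hQs := hQ.isSelfAdjoint.isSymmetric
  have h1 : Q (Q x) = Q x := congrArg (fun R : E →L[ℂ] E => R x) hQ.isIdempotentElem.eq
  have h2 : ⟪x, Q x⟫_ℂ = ⟪Q x, Q x⟫_ℂ := by
    calc ⟪x, Q x⟫_ℂ = ⟪x, Q (Q x)⟫_ℂ := by rw [h1]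
      _ = ⟪Q x, Q x⟫_ℂ := (hQs x (Q x)).symm
  rw [h2]
  exact inner_self_eq_norm_sq (𝕜 := ℂ) (Q x)

/-- For a star projection `P` and `z ⊥ ran P`: `P z = 0`. [folklore] -/
private theorem apply_eq_zero_of_mem_orthogonal_range {P : E →L[ℂ] E} (hP : IsStarProjection P)
    {z : E} (hz : z ∈ P.rangeᗮ) : P z = 0 := by
  have h1 : ⟪P z, z⟫_ℂ = 0 :=
    Submodule.inner_right_of_mem_orthogonal (LinearMap.mem_range_self (P : E →ₗ[ℂ] E) z) hz
  have h2 : RCLike.re ⟪z, P z⟫_ℂ = ‖P z‖ ^ 2 := re_inner_apply_of_isStarProjection hP z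
  rw [← inner_conj_symm, h1, map_zero, map_zero] at h2
  exact norm_eq_zero.1 (sq_eq_zero_iff.1 h2.symm)

/-- For a star projection `P` with `P z = 0`: `z ⊥ ran P`. [folklore] -/
private theorem mem_orthogonal_range_of_apply_eq_zero {P : E →L[ℂ] E} (hP : IsStarProjection P)
    {z : E} (hz : P z = 0) : z ∈ P.rangeᗮ := by
  rw [Submodule.mem_orthogonal]
  rintro u ⟨w, rfl⟩
  have hPs := hP.isSelfAdjoint.isSymmetric
  calc ⟪P w, z⟫_ℂ = ⟪w, P z⟫_ℂ := hPs w z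
    _ = 0 := by rw [hz, inner_zero_right]

/-- `(ran P ⊔ ran Q)ᗮ = ker P ∩ ker Q` for star projections. [folklore] -/
private theorem mem_orthogonal_sup_range_iff {P Q : E →L[ℂ] E} (hP : IsStarProjection P)
    (hQ : IsStarProjection Q) (z : E) :
    z ∈ (P.range ⊔ Q.range)ᗮ ↔ P z = 0 ∧ Q z = 0 := by
  rw [← Submodule.inf_orthogonal, Submodule.mem_inf]
  exact ⟨fun h ↦ ⟨apply_eq_zero_of_mem_orthogonal_range hP h.1,
      apply_eq_zero_of_mem_orthogonal_range hQ h.2⟩,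
    fun h ↦ ⟨mem_orthogonal_range_of_apply_eq_zero hP h.1,
      mem_orthogonal_range_of_apply_eq_zero hQ h.2⟩⟩

variable {R : Type*} [Ring R]

/-- In a ring, if `1 − t` is a unit then `(1 − t)⁻¹ (1 − t) = 1 = (1 − t)(1 − t)⁻¹` for
`Ring.inverse`. [folklore] -/
private theorem inverse_one_sub_mul_cancel {t : R} (h : IsUnit (1 - t)) :
    Ring.inverse (1 - t) * (1 - t) = 1 ∧ (1 - t) * Ring.inverse (1 - t) = 1 :=
  ⟨Ring.inverse_mul_cancel _ h, Ring.mul_inverse_cancel _ h⟩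

/-- `Ring.inverse (1 − t)` commutes with everything commuting with `t`. [folklore] -/
private theorem commute_inverse_one_sub {s t : R} (h : IsUnit (1 - t)) (hst : Commute s t) :
    Commute s (Ring.inverse (1 - t)) := by
  obtain ⟨u, hu⟩ := h
  rw [← hu, Ring.inverse_unit]
  have : Commute s (u : R) := by rw [hu]; exact (Commute.one_right s).sub_right hst
  exact this.units_inv_right

end Abstract

/-! ## The operators on `L²(ℝ)`: `P_λ`, `P̃_λ`, `𝓕`, `F_λ`, `D_λ` and the reflection -/

/-- `P_λ (P_λ z) = P_λ z`. [cite: Burnol2002CRAS, §3 (TeX l.259–262)] -/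
private theorem cutoffProj_cutoffProj (lam : ℝ) (z : Lp ℂ 2 (volume : Measure ℝ)) :
    cutoffProj lam (cutoffProj lam z) = cutoffProj lam z := by
  have h := congrArg (fun T : Lp ℂ 2 (volume : Measure ℝ) →L[ℂ] Lp ℂ 2 (volume : Measure ℝ) ↦ T z)
    (cutoffProj_idem lam).eq
  simpa only [mul_apply_eq_comp] using h

/-- `F_λ z = P_λ 𝓕 (P_λ z)` (unfolding). [cite: Burnol2002CRAS, Lemme 2, proof (TeX l.279–281)] -/
theorem slepianF_apply (lam : ℝ) (z : Lp ℂ 2 (volume : Measure ℝ)) :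
    slepianF lam z = cutoffProj lam (𝓕 (cutoffProj lam z : Lp ℂ 2 (volume : Measure ℝ))) := rfl

/-- `D_λ z = F_λ (F_λ z)` (unfolding). [cite: Burnol2002CRAS, Lemme 2, proof (TeX l.283–285)] -/
theorem slepianD_apply (lam : ℝ) (z : Lp ℂ 2 (volume : Measure ℝ)) :
    slepianD lam z = slepianF lam (slepianF lam z) := rfl

/-- `F_λ P_λ = F_λ`. [cite: Burnol2002CRAS, Lemme 2, proof (TeX l.279–281)] -/
private theorem slepianF_cutoffProj (lam : ℝ) (z : Lp ℂ 2 (volume : Measure ℝ)) :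
    slepianF lam (cutoffProj lam z) = slepianF lam z := by
  rw [slepianF_apply, slepianF_apply, cutoffProj_cutoffProj]

/-- `P_λ F_λ = F_λ`. [cite: Burnol2002CRAS, Lemme 2, proof (TeX l.279–281)] -/
private theorem cutoffProj_slepianF (lam : ℝ) (z : Lp ℂ 2 (volume : Measure ℝ)) :
    cutoffProj lam (slepianF lam z) = slepianF lam z := by
  rw [slepianF_apply, cutoffProj_cutoffProj]

/-- `D_λ P_λ = D_λ`. [cite: Burnol2002CRAS, Lemme 2, proof (TeX l.283–285)] -/
private theorem slepianD_cutoffProj (lam : ℝ) (z : Lp ℂ 2 (volume : Measure ℝ)) :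
    slepianD lam (cutoffProj lam z) = slepianD lam z := by
  rw [slepianD_apply, slepianD_apply, slepianF_cutoffProj]

/-- `P_λ D_λ = D_λ`. [cite: Burnol2002CRAS, Lemme 2, proof (TeX l.283–285)] -/
private theorem cutoffProj_slepianD (lam : ℝ) (z : Lp ℂ 2 (volume : Measure ℝ)) :
    cutoffProj lam (slepianD lam z) = slepianD lam z := by
  rw [slepianD_apply, cutoffProj_slepianF]

/-- `𝓕⁻¹ (R z) = 𝓕 z` on `L²` (`R` = the reflection). [folklore] -/
private theorem fourierInv_compNeg_eq_fourier (z : Lp ℂ 2 (volume : Measure ℝ)) :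
    (𝓕⁻ (Lp.compMeasurePreserving (fun x : ℝ ↦ -x) (Measure.measurePreserving_neg (volume : Measure ℝ))
      z) : Lp ℂ 2 (volume : Measure ℝ)) = 𝓕 z := by
  rw [fourierInv_compNeg, fourierInv_eq_compNeg_fourier, compNeg_compNeg]

/-- `𝓕⁻¹ z = 𝓕 z` for a class fixed by the reflection. [folklore] -/
private theorem fourierInv_eq_fourier_of_compNeg_eq {z : Lp ℂ 2 (volume : Measure ℝ)}
    (hz : Lp.compMeasurePreserving (fun x : ℝ ↦ -x) (Measure.measurePreserving_neg (volume : Measure ℝ))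
      z = z) : (𝓕⁻ z : Lp ℂ 2 (volume : Measure ℝ)) = 𝓕 z := by
  conv_lhs => rw [← hz]
  exact fourierInv_compNeg_eq_fourier z

/-- `P̃_λ (𝓕 y) = 𝓕 y` whenever `P_λ y = y` (the range of `𝓕 P_λ` lies in `ran P̃_λ`; `𝓕² = R`,
`R P_λ = P_λ R`, `𝓕⁻¹ R = 𝓕`). [cite: Burnol2002CRAS, §3 (TeX l.259–266)] -/
private theorem cutoffProjHat_fourier_of_cutoffProj_eq {lam : ℝ} {y : Lp ℂ 2 (volume : Measure ℝ)}
    (hy : cutoffProj lam y = y) :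
    cutoffProjHat lam (𝓕 y : Lp ℂ 2 (volume : Measure ℝ)) = 𝓕 y := by
  rw [cutoffProjHat_apply, fourier_fourier_eq_compNeg, ← compNeg_cutoffProj, hy,
    fourierInv_compNeg_eq_fourier]

/-- **`F_λ = P_λ P̃_λ 𝓕` on `L²(ℝ)`**: `P_λ (P̃_λ (𝓕 z)) = P_λ 𝓕 P_λ z`.
[cite: Burnol2002CRAS, §3 (TeX l.259–266)] -/
theorem cutoffProj_cutoffProjHat_fourier (lam : ℝ) (z : Lp ℂ 2 (volume : Measure ℝ)) :
    cutoffProj lam (cutoffProjHat lam (𝓕 z : Lp ℂ 2 (volume : Measure ℝ))) = slepianF lam z := by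
  rw [slepianF_apply, cutoffProjHat_apply, fourier_fourier_eq_compNeg, ← compNeg_cutoffProj,
    fourierInv_compNeg_eq_fourier]

/-- `‖𝓕 z‖ = ‖z‖` on `L²`. [folklore] -/
private theorem norm_fourier_eq (z : Lp ℂ 2 (volume : Measure ℝ)) :
    ‖(𝓕 z : Lp ℂ 2 (volume : Measure ℝ))‖ = ‖z‖ :=
  (Lp.fourierTransformₗᵢ ℝ ℂ).norm_map z

/-- **`‖F_λ‖ < 1`** ("`F_λ = P_λ𝓕₊P_λ` compact auto-adjoint de norme strictement inférieure à `1`",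
TeX l.283–284): `‖F_λ‖ ≤ ‖P_λ P̃_λ‖ < 1`. [cite: Burnol2002CRAS, Lemme 2, proof (TeX l.283–284)] -/
theorem norm_slepianF_lt_one (lam : ℝ) : ‖slepianF lam‖ < 1 := by
  refine lt_of_le_of_lt ?_ (norm_cutoffProj_comp_cutoffProjHat_lt_one lam lam)
  refine ContinuousLinearMap.opNorm_le_bound _ (norm_nonneg _) (fun z ↦ ?_)
  rw [← cutoffProj_cutoffProjHat_fourier, ← norm_fourier_eq z]
  exact (cutoffProj lam ∘L cutoffProjHat lam).le_opNorm _

/-- `‖D_λ‖ < 1`. [cite: Burnol2002CRAS, Lemme 2, proof (TeX l.283–285)] -/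
theorem norm_slepianD_lt_one (lam : ℝ) : ‖slepianD lam‖ < 1 := by
  have h := norm_slepianF_lt_one lam
  refine lt_of_le_of_lt (ContinuousLinearMap.opNorm_comp_le _ _) ?_
  exact mul_lt_one_of_nonneg_of_lt_one_left (norm_nonneg _) h h.le

/-- **`1 − D_λ` is invertible** (Neumann series, `‖D_λ‖ < 1`).
[cite: Burnol2002CRAS, Lemme 2, proof (TeX l.285–286)] -/
theorem isUnit_one_sub_slepianD (lam : ℝ) : IsUnit (1 - slepianD lam) := by
  have h := (Units.oneSub (slepianD lam) (norm_slepianD_lt_one lam)).isUnit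
  rwa [Units.val_oneSub] at h

/-- `1 + F_λ` is invertible. [cite: Burnol2002CRAS, Corollaire 5 (TeX l.327–329)] -/
theorem isUnit_one_add_slepianF (lam : ℝ) : IsUnit (1 + slepianF lam) := by
  have hn : ‖-slepianF lam‖ < 1 := by rw [norm_neg]; exact norm_slepianF_lt_one lam
  have h := (Units.oneSub (-slepianF lam) hn).isUnit
  rwa [Units.val_oneSub, sub_neg_eq_add] at h

/-- `1 − F_λ` is invertible. [cite: Burnol2002CRAS, Corollaire 5 (TeX l.330–333)] -/
theorem isUnit_one_sub_slepianF (lam : ℝ) : IsUnit (1 - slepianF lam) := by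
  have h := (Units.oneSub (slepianF lam) (norm_slepianF_lt_one lam)).isUnit
  rwa [Units.val_oneSub] at h

/-! ## The resolvent `A = (1 − D_λ)^{-1}` -/

/-- `A ((1 − D) z) = z` and `(1 − D)(A z) = z`, `A = Ring.inverse (1 − D_λ)`.
[cite: Burnol2002CRAS, Théorème 4 (TeX l.310–319)] -/
private theorem resolvent_apply (lam : ℝ) (z : Lp ℂ 2 (volume : Measure ℝ)) :
    Ring.inverse (1 - slepianD lam) (z - slepianD lam z) = z ∧
      Ring.inverse (1 - slepianD lam) z - slepianD lam (Ring.inverse (1 - slepianD lam) z) = z := by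
  obtain ⟨h1, h2⟩ := inverse_one_sub_mul_cancel (isUnit_one_sub_slepianD lam)
  have e1 := congrArg (fun T : Lp ℂ 2 (volume : Measure ℝ) →L[ℂ] Lp ℂ 2 (volume : Measure ℝ) ↦ T z) h1
  have e2 := congrArg (fun T : Lp ℂ 2 (volume : Measure ℝ) →L[ℂ] Lp ℂ 2 (volume : Measure ℝ) ↦ T z) h2
  simp only [mul_apply_eq_comp, sub_apply, one_apply_eq_self] at e1 e2
  exact ⟨e1, e2⟩

/-- `A F = F A`. [cite: Burnol2002CRAS, Théorème 4 (TeX l.310–319)] -/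
private theorem resolvent_slepianF (lam : ℝ) (z : Lp ℂ 2 (volume : Measure ℝ)) :
    Ring.inverse (1 - slepianD lam) (slepianF lam z) =
      slepianF lam (Ring.inverse (1 - slepianD lam) z) := by
  have hc : Commute (slepianF lam) (slepianD lam) := (Commute.refl _).mul_right (Commute.refl _)
  have h := (commute_inverse_one_sub (isUnit_one_sub_slepianD lam) hc).eq
  have e := congrArg (fun T : Lp ℂ 2 (volume : Measure ℝ) →L[ℂ] Lp ℂ 2 (volume : Measure ℝ) ↦ T z) h
  simp only [mul_apply_eq_comp] at e
  exact e.symm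

/-- `A` maps `ran P_λ` into itself: `P (A z) = A z` when `P z = z`.
[cite: Burnol2002CRAS, Théorème 4 (TeX l.310–319)] -/
private theorem cutoffProj_resolvent {lam : ℝ} {z : Lp ℂ 2 (volume : Measure ℝ)}
    (hz : cutoffProj lam z = z) :
    cutoffProj lam (Ring.inverse (1 - slepianD lam) z) = Ring.inverse (1 - slepianD lam) z := by
  set y := Ring.inverse (1 - slepianD lam) z with hy
  have h2 := (resolvent_apply lam z).2
  -- `y = z + D y`
  have hyz : y = z + slepianD lam y := by rw [← hy] at h2; exact (sub_eq_iff_eq_add.1 h2)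
  rw [hyz, map_add, hz, cutoffProj_slepianD]

/-! ## The reflection commutes with everything -/

/-- `R (F z) = F (R z)`. [folklore] -/
private theorem compNeg_slepianF (lam : ℝ) (z : Lp ℂ 2 (volume : Measure ℝ)) :
    Lp.compMeasurePreserving (fun x : ℝ ↦ -x) (Measure.measurePreserving_neg (volume : Measure ℝ))
        (slepianF lam z) =
      slepianF lam (Lp.compMeasurePreserving (fun x : ℝ ↦ -x)
        (Measure.measurePreserving_neg (volume : Measure ℝ)) z) := by
  rw [slepianF_apply, slepianF_apply, compNeg_cutoffProj, ← fourier_compNeg, compNeg_cutoffProj]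

/-- `R (D z) = D (R z)`. [folklore] -/
private theorem compNeg_slepianD (lam : ℝ) (z : Lp ℂ 2 (volume : Measure ℝ)) :
    Lp.compMeasurePreserving (fun x : ℝ ↦ -x) (Measure.measurePreserving_neg (volume : Measure ℝ))
        (slepianD lam z) =
      slepianD lam (Lp.compMeasurePreserving (fun x : ℝ ↦ -x)
        (Measure.measurePreserving_neg (volume : Measure ℝ)) z) := by
  rw [slepianD_apply, slepianD_apply, compNeg_slepianF, compNeg_slepianF]

/-- `R (A z) = A (R z)`, `A = (1 − D)^{-1}`. [folklore] -/
private theorem compNeg_resolvent (lam : ℝ) (z : Lp ℂ 2 (volume : Measure ℝ)) :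
    Lp.compMeasurePreserving (fun x : ℝ ↦ -x) (Measure.measurePreserving_neg (volume : Measure ℝ))
        (Ring.inverse (1 - slepianD lam) z) =
      Ring.inverse (1 - slepianD lam) (Lp.compMeasurePreserving (fun x : ℝ ↦ -x)
        (Measure.measurePreserving_neg (volume : Measure ℝ)) z) := by
  set R' := Lp.compMeasurePreserving (fun x : ℝ ↦ -x) (Measure.measurePreserving_neg (volume : Measure ℝ))
    (E := ℂ) (p := (2 : ENNReal)) with hR'
  set y := Ring.inverse (1 - slepianD lam) z with hy
  have h2 : y - slepianD lam y = z := (resolvent_apply lam z).2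
  -- `(1 − D)(R y) = R z`, then apply `A`
  have h3 : R' y - slepianD lam (R' y) = R' z := by
    rw [← compNeg_slepianD, ← map_sub, h2]
  have h4 := (resolvent_apply lam (R' y)).1
  rw [h3] at h4
  exact h4.symm

/-- An `L²` class fixed by the reflection is even. [folklore] -/
private theorem mem_evenPart_of_compNeg_eq {u : Lp ℂ 2 (volume : Measure ℝ)}
    (hu : Lp.compMeasurePreserving (fun x : ℝ ↦ -x) (Measure.measurePreserving_neg (volume : Measure ℝ))
      u = u) : u ∈ evenPart := by
  rw [Literature.NumberTheory.ConnesConsani2021.mem_evenPart_iff]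
  have h := coeFn_compNeg (F := ℂ) u
  rw [hu] at h
  filter_upwards [h] with x hx
  exact hx.symm

/-- An even `L²` class is fixed by the reflection. [folklore] -/
private theorem compNeg_eq_of_mem_evenL2 {u : Lp ℂ 2 (volume : Measure ℝ)} (hu : u ∈ evenL2) :
    Lp.compMeasurePreserving (fun x : ℝ ↦ -x) (Measure.measurePreserving_neg (volume : Measure ℝ))
      u = u := by
  refine Lp.ext ?_
  filter_upwards [coeFn_compNeg (F := ℂ) u, hu] with x hx he
  rw [hx, he]

/-! ## Théorème 4 -/

/-- **The printed vector `k = (1−D)^{-1}(Pf − F𝓕f) + 𝓕(1−D)^{-1}(P𝓕f − Ff)` has `P_λ k = P_λ f`.**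
[cite: Burnol2002CRAS, Théorème 4 (TeX l.310–319)] -/
theorem cutoffProj_thm4Vector (lam : ℝ) (f : Lp ℂ 2 (volume : Measure ℝ)) :
    cutoffProj lam (Ring.inverse (1 - slepianD lam) (cutoffProj lam f - slepianF lam (fourierL2 f)) +
        fourierL2 (Ring.inverse (1 - slepianD lam)
          (cutoffProj lam (fourierL2 f) - slepianF lam f))) = cutoffProj lam f := by
  set P := cutoffProj lam with hP
  set F := slepianF lam with hF
  set A := Ring.inverse (1 - slepianD lam) with hA
  set x₁ := P f - F (fourierL2 f) with hx₁
  set x₂ := P (fourierL2 f) - F f with hx₂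
  have hPx₁ : P x₁ = x₁ := by
    rw [hx₁, map_sub, hP, cutoffProj_cutoffProj, cutoffProj_slepianF]
  have hPx₂ : P x₂ = x₂ := by
    rw [hx₂, map_sub, hP, cutoffProj_cutoffProj, cutoffProj_slepianF]
  have hPA₁ : P (A x₁) = A x₁ := cutoffProj_resolvent hPx₁
  have hPA₂ : P (A x₂) = A x₂ := cutoffProj_resolvent hPx₂
  -- `P 𝓕 (A x₂) = P 𝓕 P (A x₂) = F (A x₂)`
  have h2 : P (fourierL2 (A x₂)) = F (A x₂) := by
    rw [fourierL2_apply, hF, slepianF_apply, ← hP, hPA₂]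
  rw [map_add, hPA₁, h2, hF, ← resolvent_slepianF, ← hA, ← map_add]
  -- `x₁ + F x₂ = (1 − D)(P f)`
  have h3 : x₁ + slepianF lam x₂ = P f - slepianD lam (P f) := by
    rw [hx₂, map_sub, hP, slepianF_cutoffProj, ← slepianD_apply, slepianD_cutoffProj, hx₁, hF]
    abel
  rw [h3]
  exact (resolvent_apply lam (P f)).1

/-- **For even `f`, the printed vector `k` has `P̃_λ k = P̃_λ f`.**
[cite: Burnol2002CRAS, Théorème 4 (TeX l.310–319)] -/
theorem cutoffProjHat_thm4Vector (lam : ℝ) {f : Lp ℂ 2 (volume : Measure ℝ)} (hf : f ∈ evenL2) :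
    cutoffProjHat lam (Ring.inverse (1 - slepianD lam) (cutoffProj lam f - slepianF lam (fourierL2 f)) +
        fourierL2 (Ring.inverse (1 - slepianD lam)
          (cutoffProj lam (fourierL2 f) - slepianF lam f))) = cutoffProjHat lam f := by
  set R' := Lp.compMeasurePreserving (fun x : ℝ ↦ -x) (Measure.measurePreserving_neg (volume : Measure ℝ))
    (E := ℂ) (p := (2 : ENNReal)) with hR'
  set P := cutoffProj lam with hP
  set Q := cutoffProjHat lam with hQ
  set F := slepianF lam with hF
  set A := Ring.inverse (1 - slepianD lam) with hA
  set x₁ := P f - F (fourierL2 f) with hx₁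
  set x₂ := P (fourierL2 f) - F f with hx₂
  have hRf : R' f = f := compNeg_eq_of_mem_evenL2 hf
  -- evenness of `x₁`, hence of `A x₁` and `F (A x₁)`
  have hRx₁ : R' x₁ = x₁ := by
    rw [hx₁, map_sub, hP, hF, compNeg_cutoffProj, compNeg_slepianF, fourierL2_apply,
      ← fourier_compNeg, hRf]
  have hRFAx₁ : R' (F (A x₁)) = F (A x₁) := by
    rw [hF, hA, compNeg_slepianF, compNeg_resolvent, hRx₁]
  have hRPFf : R' (P (fourierL2 f)) = P (fourierL2 f) := by
    rw [hP, compNeg_cutoffProj, fourierL2_apply, ← fourier_compNeg, hRf]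
  have hPx₁ : P x₁ = x₁ := by
    rw [hx₁, map_sub, hP, cutoffProj_cutoffProj, cutoffProj_slepianF]
  have hPx₂ : P x₂ = x₂ := by
    rw [hx₂, map_sub, hP, cutoffProj_cutoffProj, cutoffProj_slepianF]
  have hPA₁ : P (A x₁) = A x₁ := cutoffProj_resolvent hPx₁
  have hPA₂ : P (A x₂) = A x₂ := cutoffProj_resolvent hPx₂
  -- `Q (A x₁) = 𝓕⁻ P 𝓕 (A x₁) = 𝓕⁻ (F (A x₁)) = 𝓕 (F (A x₁))`
  have h1 : Q (A x₁) = fourierL2 (F (A x₁)) := by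
    rw [hQ, cutoffProjHat_apply, fourierL2_apply]
    have : cutoffProj lam (𝓕 (A x₁) : Lp ℂ 2 (volume : Measure ℝ)) = F (A x₁) := by
      rw [hF, slepianF_apply, ← hP, hPA₁]
    rw [this]
    exact fourierInv_eq_fourier_of_compNeg_eq hRFAx₁
  -- `Q (𝓕 (A x₂)) = 𝓕 (A x₂)`
  have h2 : Q (fourierL2 (A x₂)) = fourierL2 (A x₂) := by
    rw [hQ, fourierL2_apply]
    exact cutoffProjHat_fourier_of_cutoffProj_eq hPA₂
  rw [map_add, h1, h2, ← map_add, hF, hA, ← resolvent_slepianF, ← map_add]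
  -- `F x₁ + x₂ = (1 − D)(P 𝓕 f)`
  have h3 : slepianF lam x₁ + x₂ = P (fourierL2 f) - slepianD lam (P (fourierL2 f)) := by
    rw [hx₁, map_sub, hP, slepianF_cutoffProj, ← slepianD_apply, slepianD_cutoffProj, hx₂, hF]
    abel
  rw [h3, (resolvent_apply lam (P (fourierL2 f))).1]
  -- `Q f = 𝓕⁻ (P 𝓕 f) = 𝓕 (P 𝓕 f)` for even `f`
  rw [hQ, cutoffProjHat_apply, fourierL2_apply, hP]
  exact (fourierInv_eq_fourier_of_compNeg_eq hRPFf).symm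

/-- **Théorème 4, the projection formula**: for every real `λ` and every even `f ∈ L²(ℝ)`,
`π_λ(f) = f − (1 − D_λ)^{-1}(P_λ f − F_λ 𝓕 f) − 𝓕 (1 − D_λ)^{-1}(P_λ 𝓕 f − F_λ f)`
(`π_λ` = the orthogonal projection onto Sonin's space `S(λ,λ) = K_λ`).
[cite: Burnol2002CRAS, Théorème 4 (TeX l.310–319)] -/
theorem soninProjection_eq_thm4 (lam : ℝ) {f : Lp ℂ 2 (volume : Measure ℝ)} (hf : f ∈ evenL2) :
    soninProjection lam lam f =
      f - Ring.inverse (1 - slepianD lam) (cutoffProj lam f - slepianF lam (fourierL2 f)) -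
        fourierL2 (Ring.inverse (1 - slepianD lam)
          (cutoffProj lam (fourierL2 f) - slepianF lam f)) := by
  set R' := Lp.compMeasurePreserving (fun x : ℝ ↦ -x) (Measure.measurePreserving_neg (volume : Measure ℝ))
    (E := ℂ) (p := (2 : ENNReal)) with hR'
  set P := cutoffProj lam with hP
  set Q := cutoffProjHat lam with hQ
  set F := slepianF lam with hF
  set A := Ring.inverse (1 - slepianD lam) with hA
  set x₁ := P f - F (fourierL2 f) with hx₁
  set x₂ := P (fourierL2 f) - F f with hx₂
  set k := A x₁ + fourierL2 (A x₂) with hk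
  have hP' : IsStarProjection P := isStarProjection_cutoffProj lam
  have hQ' : IsStarProjection Q := isStarProjection_cutoffProjHat lam
  have hPk : P k = P f := cutoffProj_thm4Vector lam f
  have hQk : Q k = Q f := cutoffProjHat_thm4Vector lam hf
  -- evenness of `k`
  have hRf : R' f = f := compNeg_eq_of_mem_evenL2 hf
  have hRx₁ : R' x₁ = x₁ := by
    rw [hx₁, map_sub, hP, hF, compNeg_cutoffProj, compNeg_slepianF, fourierL2_apply,
      ← fourier_compNeg, hRf]
  have hRx₂ : R' x₂ = x₂ := by
    rw [hx₂, map_sub, hP, hF, compNeg_cutoffProj, compNeg_slepianF, fourierL2_apply,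
      ← fourier_compNeg, hRf]
  have hRk : R' k = k := by
    rw [hk, map_add, hA, compNeg_resolvent, hRx₁, fourierL2_apply, ← fourier_compNeg,
      compNeg_resolvent, hRx₂]
  -- `k ∈ W = ran P ⊔ ran Q`
  have hPx₁ : P x₁ = x₁ := by
    rw [hx₁, map_sub, hP, cutoffProj_cutoffProj, cutoffProj_slepianF]
  have hPx₂ : P x₂ = x₂ := by
    rw [hx₂, map_sub, hP, cutoffProj_cutoffProj, cutoffProj_slepianF]
  have hkW : k ∈ P.range ⊔ Q.range := by
    refine Submodule.add_mem _ (Submodule.mem_sup_left ?_) (Submodule.mem_sup_right ?_)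
    · exact LinearMap.mem_range.mpr ⟨A x₁, cutoffProj_resolvent hPx₁⟩
    · refine LinearMap.mem_range.mpr ⟨fourierL2 (A x₂), ?_⟩
      change Q (fourierL2 (A x₂)) = fourierL2 (A x₂)
      rw [hQ, fourierL2_apply]
      exact cutoffProjHat_fourier_of_cutoffProj_eq (cutoffProj_resolvent hPx₂)
  -- `f − k ∈ S(λ, λ)` and `k ⊥ S(λ, λ)`
  have hmem : f - k ∈ soninSpace lam lam := by
    refine mem_soninSpace_iff_cutoffProj.2 ⟨?_, ?_, ?_⟩
    · exact mem_evenPart_of_compNeg_eq (by rw [map_sub, hRf, hRk])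
    · change P (f - k) = 0
      rw [map_sub, hPk, sub_self]
    · change Q (f - k) = 0
      rw [map_sub, hQk, sub_self]
  have horth : f - (f - k) ∈ (soninSpace lam lam)ᗮ := by
    rw [sub_sub_cancel, Submodule.mem_orthogonal]
    intro s hs
    obtain ⟨-, hPs, hQs⟩ := mem_soninSpace_iff_cutoffProj.1 hs
    have hsW : s ∈ (P.range ⊔ Q.range)ᗮ := (mem_orthogonal_sup_range_iff hP' hQ' s).2 ⟨hPs, hQs⟩
    exact Submodule.inner_left_of_mem_orthogonal hkW hsW
  have hπ : soninProjection lam lam f = f - k :=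
    Submodule.eq_starProjection_of_mem_orthogonal hmem horth
  rw [hπ, hk, sub_add_eq_sub_sub]

/-- **Discharge of `Burnol2002CRAS_thm4`** (Burnol 2002, Théorème 4, as typed: `IsUnit (1 − D_λ)` and
the projection formula for every even square-integrable `f`).
[cite: Burnol2002CRAS, Théorème 4 (TeX l.310–319)] -/
theorem Burnol2002CRAS_thm4_holds : Burnol2002CRAS_thm4 := fun lam _ ↦
  ⟨isUnit_one_sub_slepianD lam, fun _ hf ↦ soninProjection_eq_thm4 lam hf⟩

/-! ## Corollaire 5 -/

/-- `(1 − D)^{-1}((1 ∓ F) y) = (1 ± F)^{-1} y`: with `ε = ±1`, `(1 − F²) = (1 + εF)(1 − εF)`.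
Stated for `1 + F`: `A (y − F y) = (1 + F)^{-1} y`. [cite: Burnol2002CRAS, Corollaire 5 (TeX l.327–329)] -/
private theorem resolvent_sub_slepianF (lam : ℝ) (y : Lp ℂ 2 (volume : Measure ℝ)) :
    Ring.inverse (1 - slepianD lam) (y - slepianF lam y) = Ring.inverse (1 + slepianF lam) y := by
  set F := slepianF lam with hF
  set D := slepianD lam with hD
  have hD' : D = F * F := rfl
  -- both sides solve `(1 − D) w = y − F y`; `1 − D` is injective
  have hinj : ∀ w w' : Lp ℂ 2 (volume : Measure ℝ), w - D w = w' - D w' → w = w' := by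
    intro w w' h
    have e1 := (resolvent_apply lam w).1
    have e2 := (resolvent_apply lam w').1
    rw [← hD] at e1 e2
    rw [← e1, ← e2, h]
  apply hinj
  rw [(resolvent_apply lam (y - F y)).2]
  set w := Ring.inverse (1 + F) y with hw
  -- `(1 + F) w = y`
  have h1 : w + F w = y := by
    have := congrArg (fun T : Lp ℂ 2 (volume : Measure ℝ) →L[ℂ] Lp ℂ 2 (volume : Measure ℝ) ↦ T y)
      (Ring.mul_inverse_cancel _ (isUnit_one_add_slepianF lam))
    simpa only [mul_apply_eq_comp, add_apply, one_apply_eq_self] using this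
  -- `(1 − D) w = (1 − F)((1 + F) w) = (1 − F) y`
  have h2 : D w = F (F w) := by rw [hD']; rfl
  symm
  calc w - D w = (w + F w) - F (w + F w) := by rw [h2, map_add]; abel
    _ = y - F y := by rw [h1]

/-- `(1 − D)^{-1}((1 + F) y) = (1 − F)^{-1} y`. [cite: Burnol2002CRAS, Corollaire 5 (TeX l.330–333)] -/
private theorem resolvent_add_slepianF (lam : ℝ) (y : Lp ℂ 2 (volume : Measure ℝ)) :
    Ring.inverse (1 - slepianD lam) (y + slepianF lam y) = Ring.inverse (1 - slepianF lam) y := by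
  set F := slepianF lam with hF
  set D := slepianD lam with hD
  have hD' : D = F * F := rfl
  have hinj : ∀ w w' : Lp ℂ 2 (volume : Measure ℝ), w - D w = w' - D w' → w = w' := by
    intro w w' h
    have e1 := (resolvent_apply lam w).1
    have e2 := (resolvent_apply lam w').1
    rw [← hD] at e1 e2
    rw [← e1, ← e2, h]
  apply hinj
  rw [(resolvent_apply lam (y + F y)).2]
  set w := Ring.inverse (1 - F) y with hw
  have h1 : w - F w = y := by
    have := congrArg (fun T : Lp ℂ 2 (volume : Measure ℝ) →L[ℂ] Lp ℂ 2 (volume : Measure ℝ) ↦ T y)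
      (Ring.mul_inverse_cancel _ (isUnit_one_sub_slepianF lam))
    simpa only [mul_apply_eq_comp, sub_apply, one_apply_eq_self] using this
  have h2 : D w = F (F w) := by rw [hD']; rfl
  symm
  calc w - D w = (w - F w) + F (w - F w) := by rw [h2, map_sub]; abel
    _ = y + F y := by rw [h1]

/-- **Corollaire 5, first case**: if `f` is even and `f|_{(−λ,λ)} = 0` (`P_λ f = 0`) then
`π_λ(f) = f|_{|t|>λ} − (𝓕 (1−D_λ)^{-1} P_λ 𝓕 f)|_{|t|>λ}`. [cite: Burnol2002CRAS, Corollaire 5 (TeX l.321–326)] -/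
theorem soninProjection_eq_cor5_1 (lam : ℝ) {f : Lp ℂ 2 (volume : Measure ℝ)} (hf : f ∈ evenL2)
    (h0 : cutoffProj lam f = 0) :
    soninProjection lam lam f =
      (f - cutoffProj lam f) -
        (fourierL2 (Ring.inverse (1 - slepianD lam) (cutoffProj lam (fourierL2 f))) -
          cutoffProj lam
            (fourierL2 (Ring.inverse (1 - slepianD lam) (cutoffProj lam (fourierL2 f))))) := by
  rw [soninProjection_eq_thm4 lam hf]
  set P := cutoffProj lam with hP
  set F := slepianF lam with hF
  set A := Ring.inverse (1 - slepianD lam) with hA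
  have hFf : F f = 0 := by rw [hF, ← slepianF_cutoffProj, ← hP, h0, map_zero]
  have hPy : P (P (fourierL2 f)) = P (fourierL2 f) := by rw [hP, cutoffProj_cutoffProj]
  -- `P 𝓕 A P𝓕f = F (A (P𝓕f)) = A (F (P 𝓕 f)) = A (F 𝓕 f)`
  have h1 : P (fourierL2 (A (P (fourierL2 f)))) = A (F (fourierL2 f)) := by
    have hPA : P (A (P (fourierL2 f))) = A (P (fourierL2 f)) := cutoffProj_resolvent hPy
    rw [fourierL2_apply (A (P (fourierL2 f)))]
    have : P (𝓕 (A (P (fourierL2 f))) : Lp ℂ 2 (volume : Measure ℝ)) = F (A (P (fourierL2 f))) := by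
      rw [hF, slepianF_apply, ← hP, hPA]
    rw [this, hF, hA, ← resolvent_slepianF, slepianF_cutoffProj]
  rw [h1, h0, hFf, zero_sub, sub_zero, sub_zero, map_neg]
  abel

/-- **Corollaire 5, second case**: if `f` is even and `𝓕 f = f` then
`π_λ(f) = f − (1 + 𝓕)(1 + F_λ)^{-1} P_λ f`. [cite: Burnol2002CRAS, Corollaire 5 (TeX l.327–329)] -/
theorem soninProjection_eq_cor5_2 (lam : ℝ) {f : Lp ℂ 2 (volume : Measure ℝ)} (hf : f ∈ evenL2)
    (h1 : fourierL2 f = f) :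
    soninProjection lam lam f =
      f - (Ring.inverse (1 + slepianF lam) (cutoffProj lam f) +
        fourierL2 (Ring.inverse (1 + slepianF lam) (cutoffProj lam f))) := by
  rw [soninProjection_eq_thm4 lam hf, h1]
  have h2 : cutoffProj lam f - slepianF lam f =
      cutoffProj lam f - slepianF lam (cutoffProj lam f) := by rw [slepianF_cutoffProj]
  rw [h2, resolvent_sub_slepianF]
  abel

/-- **Corollaire 5, third case**: if `f` is even and `𝓕 f = −f` then
`π_λ(f) = f − (1 − 𝓕)(1 − F_λ)^{-1} P_λ f`. [cite: Burnol2002CRAS, Corollaire 5 (TeX l.330–333)] -/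
theorem soninProjection_eq_cor5_3 (lam : ℝ) {f : Lp ℂ 2 (volume : Measure ℝ)} (hf : f ∈ evenL2)
    (h1 : fourierL2 f = -f) :
    soninProjection lam lam f =
      f - (Ring.inverse (1 - slepianF lam) (cutoffProj lam f) -
        fourierL2 (Ring.inverse (1 - slepianF lam) (cutoffProj lam f))) := by
  rw [soninProjection_eq_thm4 lam hf, h1, map_neg, map_neg, sub_neg_eq_add]
  have h2 : cutoffProj lam f + slepianF lam f =
      cutoffProj lam f + slepianF lam (cutoffProj lam f) := by rw [slepianF_cutoffProj]
  have h3 : -cutoffProj lam f - slepianF lam f = -(cutoffProj lam f + slepianF lam f) := by abel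
  rw [h3, map_neg, h2, resolvent_add_slepianF, map_neg]
  abel

/-- **Discharge of `Burnol2002CRAS_cor5`** (Burnol 2002, Corollaire 5, the three cases as typed).
[cite: Burnol2002CRAS, Corollaire 5 (TeX l.321–333)] -/
theorem Burnol2002CRAS_cor5_holds : Burnol2002CRAS_cor5 := fun lam _ _ hf ↦
  ⟨fun h0 ↦ soninProjection_eq_cor5_1 lam hf h0, fun h1 ↦ soninProjection_eq_cor5_2 lam hf h1,
    fun h1 ↦ soninProjection_eq_cor5_3 lam hf h1⟩

end Burnol2002

end Literature.Analysis.DeBrangesSpaces
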